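import Mathlib

/-!
# Crux `MatrixDescartes` (stmt-ValiantsHypothesis-18050), line `Lift` — registered stub `stub_blockSector`

BLOCK SUMS ARE ADDITIVE in the real-zero count of lacunary matrix pencils: for real square
coefficient matrices `Sₗ` (size `m`) and `Tₗ` (size `n`) and exponents `dₗ` (`l < K`), the
block-diagonal pencil `∑ₗ X^{dₗ} (Sₗ ⊕ Tₗ)` satisfies
`Z(S ⊕ T) ≤ Z(S) + Z(T)`, where `Z(·)` is the number of distinct real zeros of the determinant.

Proof:
* the pencil matrix is itself block diagonal,
  `∑ₗ X^{dₗ} • (fromBlocks Sₗ 0 0 Tₗ).map C = fromBlocks (∑ₗ X^{dₗ} • Sₗ.map C) 0 0 (∑ₗ X^{dₗ} • Tₗ.map C)`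
  (`StubBlockSector.sum_smul_fromBlocks_map`, from `Matrix.fromBlocks_map`, `Matrix.fromBlocks_smul`
  and a finite-sum version of `Matrix.fromBlocks_add`);
* hence its determinant is the product `det (∑ₗ X^{dₗ} Sₗ) * det (∑ₗ X^{dₗ} Tₗ)`
  (`Matrix.det_fromBlocks_zero₂₁`);
* the distinct roots of a product `p * q` number at most those of `p` plus those of `q`
  (`StubBlockSector.card_roots_toFinset_mul_le`: if `p * q = 0` there are no counted roots, otherwise
  `Polynomial.roots_mul`, `Multiset.toFinset_add`, `Finset.card_union_le`).

Elementary; Mathlib only (axioms `propext`, `Classical.choice`, `Quot.sound`).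
-/

-- layout Summits/ValiantsHypothesis/ValiantsHypothesis forces the duplicated namespace component
set_option linter.dupNamespace false

namespace Summit.ValiantsHypothesis.ValiantsHypothesis.Theorems.LacunarySymmetroidMatrixDescartes

open Polynomial Matrix Finset
open scoped BigOperators

namespace StubBlockSector

/-- Finite sums of block-diagonal matrices are block diagonal, blockwise. -/
theorem sum_fromBlocks_zero {R : Type*} [AddCommMonoid R] {ι n n' : Type*} (s : Finset ι)
    (A : ι → Matrix n n R) (B : ι → Matrix n' n' R) :
    ∑ i ∈ s, Matrix.fromBlocks (A i) 0 0 (B i)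
      = Matrix.fromBlocks (∑ i ∈ s, A i) 0 0 (∑ i ∈ s, B i) := by
  -- adapted from Literature/NumberTheory/Automorphic/BlockDiagonalGL (`sum_fromBlocks_zero`)
  classical
  induction s using Finset.induction_on with
  | empty => simp
  | insert a s ha ih =>
    rw [Finset.sum_insert ha, Finset.sum_insert ha, Finset.sum_insert ha, ih, fromBlocks_add]
    simp

/-- The block-diagonal lacunary pencil is the block-diagonal matrix of the two lacunary pencils:
`∑ₗ X^{dₗ} • (fromBlocks Sₗ 0 0 Tₗ).map C = fromBlocks (∑ₗ X^{dₗ} • Sₗ.map C) 0 0 (∑ₗ X^{dₗ} • Tₗ.map C)`. -/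
theorem sum_smul_fromBlocks_map {K m n : ℕ} (d : Fin K → ℕ) (S : Fin K → Matrix (Fin m) (Fin m) ℝ)
    (T : Fin K → Matrix (Fin n) (Fin n) ℝ) :
    ∑ l, ((Polynomial.X : Polynomial ℝ) ^ d l) • (Matrix.fromBlocks (S l) 0 0 (T l)).map Polynomial.C
      = Matrix.fromBlocks (∑ l, ((Polynomial.X : Polynomial ℝ) ^ d l) • (S l).map Polynomial.C) 0 0
          (∑ l, ((Polynomial.X : Polynomial ℝ) ^ d l) • (T l).map Polynomial.C) := by
  rw [← sum_fromBlocks_zero]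
  refine Finset.sum_congr rfl fun l _ => ?_
  rw [fromBlocks_map, fromBlocks_smul]
  simp [Matrix.map_zero _ Polynomial.C_0]

/-- The distinct roots of a product of two real polynomials number at most those of the factors
(if the product is the zero polynomial, no root is counted). -/
theorem card_roots_toFinset_mul_le (p q : Polynomial ℝ) :
    (p * q).roots.toFinset.card ≤ p.roots.toFinset.card + q.roots.toFinset.card := by
  by_cases hpq : p * q = 0
  · simp [hpq]
  · rw [Polynomial.roots_mul hpq, Multiset.toFinset_add]
    exact Finset.card_union_le _ _

end StubBlockSector

/-- **Registered stub `stub_blockSector`** (block sums are additive): the block-diagonal pencil with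
blocks `Sₗ ⊕ Tₗ` has determinant `det (∑ X^{dₗ} Sₗ) · det (∑ X^{dₗ} Tₗ)`
(`Matrix.det_fromBlocks_zero₂₁`), so its distinct real zeros number at most `Z(S) + Z(T)` (if either
factor is the zero polynomial the product has no counted roots). -/
theorem stub_blockSector (K m n : ℕ) (d : Fin K → ℕ) (S : Fin K → Matrix (Fin m) (Fin m) ℝ)
    (T : Fin K → Matrix (Fin n) (Fin n) ℝ) :
    (Matrix.det (∑ l, ((Polynomial.X : Polynomial ℝ) ^ d l) •
        (Matrix.fromBlocks (S l) 0 0 (T l)).map Polynomial.C)).roots.toFinset.card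
      ≤ (Matrix.det (∑ l, ((Polynomial.X : Polynomial ℝ) ^ d l) • (S l).map Polynomial.C)).roots.toFinset.card
        + (Matrix.det (∑ l, ((Polynomial.X : Polynomial ℝ) ^ d l) • (T l).map Polynomial.C)).roots.toFinset.card := by
  rw [StubBlockSector.sum_smul_fromBlocks_map, Matrix.det_fromBlocks_zero₂₁]
  exact StubBlockSector.card_roots_toFinset_mul_le _ _

end Summit.ValiantsHypothesis.ValiantsHypothesis.Theorems.LacunarySymmetroidMatrixDescartes
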